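import Literature.NumberTheory.Automorphic.PadicPlaceCoefficientRingFinite
import Mathlib.LinearAlgebra.Matrix.Charpoly.LinearMap
import HarnessLib

/-!
# Eigenvalues seen on a finitely generated stable `ℤ_p`-lattice are integral; the divisibility bound
# `|μ| ≤ |p|^s`

Topic `NumberTheory/Automorphic`; namespace `Literature.NumberTheory.Automorphic`.  Theorems only
(and one auxiliary definition with a body); no named fact, no instance, no `sorry`.

Let `H` be a `ℚ̄_p`-vector space, `L ⊆ H` a finitely generated `ℤ_p`-submodule, `N` a
`ℚ̄_p`-linear endomorphism of `H` with `N(L) ⊆ p^s L`, and `η ∈ L` a non-zero vector with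
`N η = μ η`.  Then **`|μ| ≤ |p|^s`** (`norm_le_of_eigenvector_mem_fg`): the `ℤ_p`-linear map
`N' = p^{-s} N|_L : L → L` satisfies a monic polynomial over `ℤ_p` (Cayley–Hamilton for finitely
generated modules, Mathlib `LinearMap.exists_monic_and_aeval_eq_zero`), its "eigenvalue" `μ / p^s`
on `η` is therefore integral over `ℤ_p`, hence of norm `≤ 1`
(`norm_le_one_of_isIntegral_padicInt`: `ℤ̄_p` is integrally closed).  The case `s = 0` is the
integrality of eigenvalues of operators preserving a lattice (`norm_le_one_of_eigenvector_mem_fg`).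

This is the mechanism behind the last step of the proof of [Scholze2015, Thm. V.4.1 / Cor. V.4.2
(continuity of the eigencharacter)]: for a Hecke operator `T` and a polynomial `P` with
`P(T)^{q+1} H^q(X_K, ℳ_ξ) ⊆ p^s H^q(X_K, ℳ_ξ)` (Hochschild–Serre nilpotence), an eigenclass with
eigenvalue `a` in `H^q(X_K, ℳ_ξ) ⊗ ℚ̄_p` forces `|P(a)|^{q+1} ≤ |p|^s` — the eigensystem is
continuous for the topology of the completed Hecke algebra.

## References

* P. Scholze, *On torsion in the cohomology of locally symmetric varieties*, Ann. of Math. 182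
  (2015), §V.4, Thm. V.4.1 and Cor. V.4.2 (arXiv:1306.2070, p. 67). [Scholze2015]
* N. Bourbaki, *Commutative Algebra*, Ch. V §1 no. 1 (integral elements; Cayley–Hamilton trick).
  [folklore]
-/

noncomputable section

open Polynomial

namespace Literature.NumberTheory.Automorphic

variable (p : ℕ) [Fact p.Prime] {H : Type*} [AddCommGroup H] [Module (PadicAlgCl p) H]
  [Module ℤ_[p] H] [IsScalarTower ℤ_[p] (PadicAlgCl p) H]

/-- `ℤ_p`-scalars act through `ℚ̄_p`. [folklore] -/
theorem padicInt_smul_eq (z : ℤ_[p]) (x : H) : z • x = (algebraMap ℤ_[p] (PadicAlgCl p) z) • x :=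
  (algebraMap_smul (PadicAlgCl p) z x).symm

/-- Multiplication by `p^s` is injective on a `ℚ̄_p`-vector space. [folklore] -/
theorem pow_smul_injective (s : ℕ) :
    Function.Injective fun x : H => ((p : ℤ_[p]) ^ s : ℤ_[p]) • x := by
  have hp : (p : ℕ).Prime := Fact.out
  have hc : (algebraMap ℤ_[p] (PadicAlgCl p) ((p : ℤ_[p]) ^ s)) ≠ 0 := by
    rw [map_pow, map_natCast]
    exact pow_ne_zero s (Nat.cast_ne_zero.2 hp.ne_zero)
  intro x y hxy
  have h : (algebraMap ℤ_[p] (PadicAlgCl p) ((p : ℤ_[p]) ^ s)) • x =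
      (algebraMap ℤ_[p] (PadicAlgCl p) ((p : ℤ_[p]) ^ s)) • y := by
    simpa only [padicInt_smul_eq] using hxy
  exact smul_right_injective H hc h

section Divided

variable {p}
variable (L : Submodule ℤ_[p] H) (N : H →ₗ[PadicAlgCl p] H) (s : ℕ)
  (hN : ∀ x ∈ L, ∃ y ∈ L, N x = ((p : ℤ_[p]) ^ s : ℤ_[p]) • y)

/-- **The divided operator `N' = p^{-s} N|_L : L → L`** (well defined as `p^s` is injective on `H`).
[folklore] -/
def dividedEnd : L →ₗ[ℤ_[p]] L where
  toFun x := ⟨(hN x x.2).choose, (hN x x.2).choose_spec.1⟩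
  map_add' x y := by
    refine Subtype.ext (pow_smul_injective p s ?_)
    change ((p : ℤ_[p]) ^ s : ℤ_[p]) • (hN _ (x + y).2).choose =
      ((p : ℤ_[p]) ^ s : ℤ_[p]) • ((hN x x.2).choose + (hN y y.2).choose)
    rw [smul_add, ← (hN x x.2).choose_spec.2, ← (hN y y.2).choose_spec.2,
      ← (hN _ (x + y).2).choose_spec.2, Submodule.coe_add, map_add]
  map_smul' c x := by
    refine Subtype.ext (pow_smul_injective p s ?_)
    change ((p : ℤ_[p]) ^ s : ℤ_[p]) • (hN _ (c • x).2).choose =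
      ((p : ℤ_[p]) ^ s : ℤ_[p]) • (c • (hN x x.2).choose)
    rw [smul_comm, ← (hN x x.2).choose_spec.2, ← (hN _ (c • x).2).choose_spec.2,
      Submodule.coe_smul, padicInt_smul_eq p c (x : H), map_smul, ← padicInt_smul_eq]

/-- Defining property: `p^s • N' x = N x`. [folklore] -/
theorem pow_smul_dividedEnd (x : L) :
    ((p : ℤ_[p]) ^ s : ℤ_[p]) • ((dividedEnd L N s hN x : L) : H) = N x :=
  (hN x x.2).choose_spec.2.symm

variable {L N s hN}

/-- On an eigenvector `η ∈ L` of `N` with eigenvalue `μ`, `N'` acts by `μ / p^s`. [folklore] -/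
theorem dividedEnd_apply_of_eigenvector {η : H} (hη : η ∈ L) {μ : PadicAlgCl p} (hμ : N η = μ • η) :
    ((dividedEnd L N s hN ⟨η, hη⟩ : L) : H) = (μ / (p : PadicAlgCl p) ^ s) • η := by
  have hp : (p : ℕ).Prime := Fact.out
  have hc : ((p : PadicAlgCl p) ^ s) ≠ 0 := pow_ne_zero s (Nat.cast_ne_zero.2 hp.ne_zero)
  refine pow_smul_injective p s ?_
  change ((p : ℤ_[p]) ^ s : ℤ_[p]) • ((dividedEnd L N s hN ⟨η, hη⟩ : L) : H) =
    ((p : ℤ_[p]) ^ s : ℤ_[p]) • ((μ / (p : PadicAlgCl p) ^ s) • η)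
  rw [pow_smul_dividedEnd, hμ, padicInt_smul_eq, map_pow, map_natCast, smul_smul,
    mul_div_cancel₀ _ hc]

/-- Powers of `N'` on the eigenvector. [folklore] -/
theorem dividedEnd_pow_apply_of_eigenvector {η : H} (hη : η ∈ L) {μ : PadicAlgCl p}
    (hμ : N η = μ • η) (n : ℕ) :
    (((dividedEnd L N s hN ^ n) ⟨η, hη⟩ : L) : H) = (μ / (p : PadicAlgCl p) ^ s) ^ n • η := by
  induction n with
  | zero => simp
  | succ n ih =>
    rw [pow_succ', Module.End.mul_apply]
    -- `N'^n η = c^n η` is again in `L`, and `N'` is `ℤ_p`-linear only; compute via `p^s`-injectivity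
    have hp : (p : ℕ).Prime := Fact.out
    have hc : ((p : PadicAlgCl p) ^ s) ≠ 0 := pow_ne_zero s (Nat.cast_ne_zero.2 hp.ne_zero)
    refine pow_smul_injective p s ?_
    change ((p : ℤ_[p]) ^ s : ℤ_[p]) • ((dividedEnd L N s hN ((dividedEnd L N s hN ^ n) ⟨η, hη⟩) : L) : H) =
      ((p : ℤ_[p]) ^ s : ℤ_[p]) • ((μ / (p : PadicAlgCl p) ^ s) ^ (n + 1) • η)
    rw [pow_smul_dividedEnd, ih, map_smul, hμ, smul_smul, padicInt_smul_eq, map_pow, map_natCast,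
      smul_smul, pow_succ]
    congr 1
    rw [mul_comm ((p : PadicAlgCl p) ^ s), mul_assoc, div_mul_cancel₀ _ hc]

/-- Polynomials in `N'` on the eigenvector: `Q(N') η = Q(μ / p^s) η`. [folklore] -/
theorem aeval_dividedEnd_apply_of_eigenvector {η : H} (hη : η ∈ L) {μ : PadicAlgCl p}
    (hμ : N η = μ • η) (Q : ℤ_[p][X]) :
    ((Polynomial.aeval (dividedEnd L N s hN) Q ⟨η, hη⟩ : L) : H) =
      (Q.map (algebraMap ℤ_[p] (PadicAlgCl p))).eval (μ / (p : PadicAlgCl p) ^ s) • η := by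
  induction Q using Polynomial.induction_on' with
  | add P Q hP hQ =>
    rw [map_add, LinearMap.add_apply, Submodule.coe_add, hP, hQ, Polynomial.map_add,
      Polynomial.eval_add, add_smul]
  | monomial n c =>
    rw [Polynomial.aeval_monomial, Module.End.mul_apply, Module.algebraMap_end_apply,
      Submodule.coe_smul, dividedEnd_pow_apply_of_eigenvector hη hμ, Polynomial.map_monomial,
      Polynomial.eval_monomial, padicInt_smul_eq, smul_smul]

include hN in
variable (L N s hN) in
/-- **`|μ| ≤ |p|^s`**: if `N(L) ⊆ p^s L` for a finitely generated `ℤ_p`-submodule `L` of a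
`ℚ̄_p`-vector space and `N η = μ η` for a non-zero `η ∈ L`, then `|μ| ≤ |p|^s` — `μ / p^s` is an
"eigenvalue" of the `ℤ_p`-linear `N' = p^{-s}N|_L`, which satisfies a monic polynomial over `ℤ_p`
(Cayley–Hamilton), so `μ / p^s` is integral over `ℤ_p`, of norm `≤ 1`.
[cite: Scholze2015, §V.4 (proof of Thm. V.4.1 / Cor. V.4.2)] -/
theorem norm_le_of_eigenvector_mem_fg (hL : L.FG) {η : H} (hη : η ∈ L) (hη0 : η ≠ 0)
    {μ : PadicAlgCl p} (hμ : N η = μ • η) : ‖μ‖ ≤ ‖(p : PadicAlgCl p)‖ ^ s := by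
  have hp : (p : ℕ).Prime := Fact.out
  haveI : Module.Finite ℤ_[p] L := Module.Finite.iff_fg.2 hL
  obtain ⟨Q, hQm, hQ⟩ := LinearMap.exists_monic_and_aeval_eq_zero ℤ_[p] (dividedEnd L N s hN)
  -- `Q(μ / p^s) η = Q(N') η = 0`, so `Q(μ / p^s) = 0`
  have h0 : (Q.map (algebraMap ℤ_[p] (PadicAlgCl p))).eval (μ / (p : PadicAlgCl p) ^ s) = 0 := by
    have h := aeval_dividedEnd_apply_of_eigenvector (L := L) (N := N) (s := s) (hN := hN) hη hμ Q
    rw [hQ, LinearMap.zero_apply, Submodule.coe_zero] at h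
    exact (smul_eq_zero.1 h.symm).resolve_right hη0
  -- hence `μ / p^s` is integral over `ℤ_p`, of norm `≤ 1`
  have hint : IsIntegral ℤ_[p] (μ / (p : PadicAlgCl p) ^ s) :=
    ⟨Q, hQm, by rwa [← Polynomial.eval_map]⟩
  have h1 := ParallelWeight.norm_le_one_of_isIntegral_padicInt p hint
  have hc : ((p : PadicAlgCl p) ^ s) ≠ 0 := pow_ne_zero s (Nat.cast_ne_zero.2 hp.ne_zero)
  rw [norm_div, div_le_one (norm_pos_iff.2 hc), norm_pow] at h1
  exact h1

variable (L N) in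
/-- **Eigenvalues on a stable finitely generated `ℤ_p`-lattice are integral**: if `N(L) ⊆ L` and
`N η = μ η` for a non-zero `η ∈ L`, then `|μ| ≤ 1` (the case `s = 0`). [folklore] -/
theorem norm_le_one_of_eigenvector_mem_fg (hL : L.FG) (hN0 : ∀ x ∈ L, N x ∈ L) {η : H} (hη : η ∈ L)
    (hη0 : η ≠ 0) {μ : PadicAlgCl p} (hμ : N η = μ • η) : ‖μ‖ ≤ 1 := by
  have h := norm_le_of_eigenvector_mem_fg L N 0 (fun x hx => ⟨N x, hN0 x hx, by simp⟩) hL hη hη0 hμ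
  simpa using h

end Divided

end Literature.NumberTheory.Automorphic
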